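import Summits.Ventures.DiscreteObjects.PP12.NoPlanarOrderThree
import Summits.Ventures.DiscreteObjects.PP12.LiveCellsOrder3

/-!
# PP(12): the planar order-3 cell is closed in the kernel — census consequences
Framing: lottery ticket; floor = certified bounds/negative ranges.

`NoPlanarOrderThree.no_planar_order_three` (designs g10) proves that no collineation `σ` of a projective plane of order 12 with
`σ³ = 1` has a planar fixed structure of order 3. This file records the census consequences (cell pub-namedobj, target M):

* `noPlanarOrder3Order12 : NoPlanarOrder3Order12` — the typed census statement of `LiveCellsOrder3` (so far 'NOT proved, beyond
  bound k') is now a THEOREM;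
* `order_three_structure_v2` — a collineation `σ ≠ 1` with `σ³ = 1` of a plane of order 12 is an ELATION (excluded in print,
  Janko–van Trung 1981; kernel-equivalent to `NoLiftableSTD3_12_4`) or of FLAG type (all fixed points on a fixed line `l`, all fixed
  lines through a fixed point `c ∈ l`, `1, 4, 7` or `10` fixed points and as many fixed lines): the live cell `|G| = 3` is the flag
  cell alone;
* `noOrderThree_of_elation_flag`, `noOrderThree_of_liftable_flag` — `NoOrderThreeOrder12` follows from the elation cell (resp. its
  array form) and the flag cell only;
* `card_collineationGroup_eq_one_v4` — rigid endgame with one hypothesis fewer: Janko–van Trung's `{2,3}`-group theorem (named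
  fact), the two finite array statements `NoLiftableSTD2_12_6`, `NoLiftableSTD3_12_4` and the flag-cell statement
  `NoFlagOrder3Order12` force every collineation group of a projective plane of order 12 to be trivial.
* THE SHORT REASON, in general form (`mem_fixedLine_of_card_fixed`, any order `n`): a collineation with at least `n + 1` fixed
  points leaves NO exterior point — every non-fixed point lies on a fixed line. (If `Q` is on no fixed line, the lines `Qx`, `x`
  fixed, are `≥ n + 1` distinct lines through `Q`, i.e. all of them; so the line `Q σQ` passes through a fixed point `x`, and
  `σ(xQ) = xσQ = xQ` is a fixed line through `Q`.) Hence a Bruck-extremal subplane (order `m` in a plane of order `m² + m`, which has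
  exterior points) is never the fixed structure of a non-trivial collineation; `no_planar_order_three'` re-derives the planar cell
  from this in three lines (the double count of `NoPlanarOrderThree` is a longer route to the same fact).
No `sorry`, no new axioms, no new definitions.
-/

namespace Summit.Ventures.DiscreteObjects.PP12

open Configuration Finset Literature.Combinatorics.Designs Summit.Ventures.DiscreteObjects.STD
open scoped Classical

/-- **The planar order-3 census cell of PP(12) is EMPTY** (theorem, not hypothesis). -/
theorem noPlanarOrder3Order12 : NoPlanarOrder3Order12 := by
  intro P L _ _ _ _ h12 σ hq h
  obtain ⟨hf13, hg13, hk4, ht4⟩ := h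
  exact Collineation.no_planar_order_three σ h12 hq hf13 hg13 hk4 ht4

/-- **Fixed structure of a collineation of order 3 of a projective plane of order 12, v2:** elation, or flag type with
`1, 4, 7` or `10` fixed points — the planar case of `order_three_structure` cannot occur. -/
theorem Collineation.order_three_structure_v2 {P L : Type*} [Membership P L] [ProjectivePlane P L] [Fintype P] [Fintype L]
    [DecidableEq P] [DecidableEq L] (σ : Collineation P L) (h12 : ProjectivePlane.order P L = 12) (hne : σ.onPoints ≠ 1)
    (hq : σ.onPoints ^ 3 = 1) :
    (∃ (l : L) (c : P), σ.IsAxis l ∧ σ.IsCenter c ∧ c ∈ l ∧ fixedCard σ.onPoints = 13 ∧ fixedCard σ.onLines = 13) ∨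
    (∃ (l : L) (c : P), σ.onLines l = l ∧ σ.onPoints c = c ∧ c ∈ l ∧
      (∀ p : P, σ.onPoints p = p → p ∈ l) ∧ (∀ m : L, σ.onLines m = m → c ∈ m) ∧
      (fixedCard σ.onPoints = 1 ∨ fixedCard σ.onPoints = 4 ∨ fixedCard σ.onPoints = 7 ∨ fixedCard σ.onPoints = 10) ∧
      (fixedCard σ.onLines = 1 ∨ fixedCard σ.onLines = 4 ∨ fixedCard σ.onLines = 7 ∨ fixedCard σ.onLines = 10)) := by
  rcases σ.order_three_structure h12 hne hq with h | ⟨hf13, hg13, hk4, ht4⟩ | h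
  · exact Or.inl h
  · exact (σ.no_planar_order_three h12 hq hf13 hg13 hk4 ht4).elim
  · exact Or.inr h

/-- The live cell `|G| = 3` is the union of the elation cell and the flag cell. -/
theorem noOrderThree_of_elation_flag (hE : NoElationOrder3Order12) (hF : NoFlagOrder3Order12) : NoOrderThreeOrder12 :=
  noOrderThree_of_subcells hE noPlanarOrder3Order12 hF

/-- The same with the elation cell in its finite array form. -/
theorem noOrderThree_of_liftable_flag (hE : NoLiftableSTD3_12_4) (hF : NoFlagOrder3Order12) : NoOrderThreeOrder12 :=
  noOrderThree_of_arrays hE noPlanarOrder3Order12 hF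

/-- **Rigid endgame, v4.** Janko–van Trung's `{2,3}`-group theorem (named fact), the finite array statements `NoLiftableSTD2_12_6`
(involution cell) and `NoLiftableSTD3_12_4` (order-3 elation cell), and the flag-cell census statement `NoFlagOrder3Order12` force
every collineation group of a projective plane of order 12 to be trivial. (v3 = `card_collineationGroup_eq_one_of_arrays` needed the
planar cell as a fourth hypothesis.) -/
theorem card_collineationGroup_eq_one_v4 (hJvT : CollineationGroupIsTwoThreeGroup)
    (h2 : NoLiftableSTD2_12_6) (h3E : NoLiftableSTD3_12_4) (h3F : NoFlagOrder3Order12)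
    (P L : Type) [Membership P L] [Fintype P] [Fintype L] [ProjectivePlane P L] (h12 : ProjectivePlane.order P L = 12)
    (G : Type) [Group G] [Fintype G] [MulAction G P] [MulAction G L] (hG : IsCollineationGroup G P L) :
    Fintype.card G = 1 :=
  card_collineationGroup_eq_one_of_arrays hJvT h2 h3E noPlanarOrder3Order12 h3F P L h12 G hG

namespace Collineation

variable {P L : Type*} [Membership P L] [ProjectivePlane P L] [Fintype P] [Fintype L]
  [DecidableEq P] [DecidableEq L] (σ : Collineation P L)

/-- **A collineation with at least `n + 1` fixed points leaves no exterior point**: every non-fixed point lies on a fixed line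
(any finite projective plane of order `n`). -/
theorem mem_fixedLine_of_card_fixed (hf : ProjectivePlane.order P L + 1 ≤ fixedCard σ.onPoints) {Q : P}
    (hQ : σ.onPoints Q ≠ Q) : ∃ l : L, σ.onLines l = l ∧ Q ∈ l := by
  by_contra hcon
  push Not at hcon
  have hQX : σ.onPoints Q ≠ Q ∧ ∀ l : L, σ.onLines l = l → Q ∉ l := ⟨hQ, hcon⟩
  set S : Finset P := univ.filter fun x : P => σ.onPoints x = x with hS
  have hScard : ProjectivePlane.order P L + 1 ≤ S.card := hf
  -- lines through Q
  set LQ : Finset L := univ.filter fun m : L => Q ∈ m with hLQ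
  have hLQcard : LQ.card = ProjectivePlane.order P L + 1 := by
    rw [hLQ, ← Fintype.card_subtype, ← Nat.card_eq_fintype_card]
    exact ProjectivePlane.lineCount_eq L Q
  -- x ↦ line Qx is injective on S
  have hneS : ∀ x ∈ S, Q ≠ x := fun x hx e => hQ (e ▸ (by simpa [hS] using hx))
  haveI : Nonempty L := ⟨(HasLines.mkLine hQ.symm : L)⟩
  let g : P → L := fun x => if h : Q ≠ x then HasLines.mkLine h else Classical.arbitrary L
  have hg : ∀ x ∈ S, Q ∈ g x ∧ x ∈ g x := fun x hx => by
    simp only [g, dif_pos (hneS x hx)]; exact HasLines.mkLine_ax (hneS x hx)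
  have hmaps : ∀ x ∈ S, g x ∈ LQ := fun x hx => by simp [hLQ, (hg x hx).1]
  have hinj : Set.InjOn g S := by
    intro x hx x' hx' heq
    by_contra hxx'
    have fx : σ.onPoints x = x := by simpa [hS] using hx
    have fx' : σ.onPoints x' = x' := by simpa [hS] using hx'
    have h1 := hg x hx
    have h2 := hg x' hx'
    rw [← heq] at h2
    exact hcon (g x) (σ.line_fixed_of_two_fixed h1.2 h2.2 hxx' fx fx') h1.1
  -- hence the image is all of LQ, and the line Q σQ is some Qx with x fixed
  have himg : S.image g = LQ := by
    apply Finset.eq_of_subset_of_card_le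
    · intro m hm
      obtain ⟨x, hx, rfl⟩ := Finset.mem_image.mp hm
      exact hmaps x hx
    · rw [Finset.card_image_of_injOn hinj, hLQcard]; exact hScard
  set m : L := HasLines.mkLine hQ.symm with hm
  have hQm : Q ∈ m := (HasLines.mkLine_ax hQ.symm).1
  have hσQm : σ.onPoints Q ∈ m := (HasLines.mkLine_ax hQ.symm).2
  have hmLQ : m ∈ S.image g := by rw [himg]; simp [hLQ, hQm]
  obtain ⟨x, hx, hxm⟩ := Finset.mem_image.mp hmLQ
  have fx : σ.onPoints x = x := by simpa [hS] using hx
  have hxm' : x ∈ m := by rw [← hxm]; exact (hg x hx).2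
  exact σ.map_not_mem_of_exterior fx hQX hxm' hQm hσQm

/-- **No planar collineation of order 3 on a plane of order 12 — the three-line proof.** (13 = 12 + 1 fixed points leave no exterior
point by `mem_fixedLine_of_card_fixed`, but the planar structure has 27 of them.) -/
theorem no_planar_order_three' (h12 : ProjectivePlane.order P L = 12) (hf13 : fixedCard σ.onPoints = 13)
    (hg13 : fixedCard σ.onLines = 13) (hk4 : ∀ l : L, σ.onLines l = l → σ.fixedOnLine l = 4) : False := by
  have h27 := σ.card_exterior_points h12 hf13 hg13 hk4
  obtain ⟨Q, hQ⟩ := Finset.card_pos.mp (by rw [h27]; norm_num :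
    0 < (univ.filter fun x : P => σ.onPoints x ≠ x ∧ ∀ l : L, σ.onLines l = l → x ∉ l).card)
  simp only [mem_filter, mem_univ, true_and] at hQ
  obtain ⟨l, hl, hQl⟩ := σ.mem_fixedLine_of_card_fixed (by rw [h12, hf13]) hQ.1
  exact hQ.2 l hl hQl

end Collineation

/-- **Attribution (words correction F-M15, lead gen 12, 2026-08-22).** `noPlanarOrder3Order12` is the case `(m, n) = (3, 12)` of
ROTH's theorem: if the fixed structure of a collineation group of a finite projective plane of order `n` is a subplane of order `m`,
then `m² = n` or `m (m + 1) ≤ n − 2` [cite: Roth1964, §3] [cite: Dembowski1968, §4.1 result 6]. The files `NoPlanarOrderThree` /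
`NoPlanarOrderThreeCensus` are a kernel FORMALISATION of that case (replication), not a new result; the module docstrings' remark that
the case is 'treated in print only inside groups of order 9 and by computer (Akiyama–Suetake–Tanaka 2019)' describes that paper, which
does not use Roth's theorem, and must not be read as a novelty claim. -/
theorem noPlanarOrder3Order12_roth1964 : NoPlanarOrder3Order12 := noPlanarOrder3Order12

/-- **Attribution of the general lemma.** `Collineation.mem_fixedLine_of_card_fixed` (a collineation of a plane of order `n` with at
least `n + 1` fixed points leaves no point off its fixed lines) is contained in BAER's 1946 argument reproduced as the proof of
[cite: Dembowski1968, §4.1 result 7] ('`f(φ) ≥ n` implies `φ` quasicentral': for a point `w` on no fixed line the line `w·wφ` would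
carry a fixed point and hence be fixed). Kernel formalisation (replication), recorded here so that the tree carries the placement;
this restatement is definitionally the landed lemma. -/
theorem Collineation.mem_fixedLine_of_card_fixed_baer1946 {P L : Type*} [Membership P L]
    [Configuration.ProjectivePlane P L] [Fintype P] [Fintype L] [DecidableEq P] [DecidableEq L] (σ : Collineation P L)
    (hf : Configuration.ProjectivePlane.order P L + 1 ≤ fixedCard σ.onPoints) {Q : P} (hQ : σ.onPoints Q ≠ Q) :
    ∃ l : L, σ.onLines l = l ∧ Q ∈ l :=
  σ.mem_fixedLine_of_card_fixed hf hQ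

end Summit.Ventures.DiscreteObjects.PP12
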